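import Summits.BirchSwinnertonDyer.Rank1Residual.GaloisImage.MazurTatePullbackFamily
import Summits.BirchSwinnertonDyer.Rank1Residual.GaloisImage.CyclotomicNormalBasis
import Mathlib.Analysis.SpecialFunctions.Pow.Complex
import HarnessLib

/-!
# Character components for the Kato side: the Mazur–Tate datum, the `n`-normalised Kato factors,
# the depletion and cusp elements of `ℚ[(ℤ/n)ˣ]`
# (cell `b2b-bsdres`, team n1011, ROUTE-1 PORT anatomy (P-KIM); R1-71/R1-72: PK-4b
# `KatoZetaValueDerivativeCongruence`, layer PK-4b-C4b-2 (i); seat p15 GEN 10)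

HONEST FRAMING (cell `b2b-bsdres`, run/shared/lean/b2b/bsd-rank1-residual/, verbatim in every
file): the goal of the cell is to DELETE the COMBINATION-SHAPED residual classes of the
Birch–Swinnerton-Dyer formula for ALL analytic-rank `≤ 1` elliptic curves over `ℚ` — "full BSD
formula for every rank `≤ 1` curve in class `C`" assembled STRICTLY from published theorems — so
that the rank-`≤ 1` remainder becomes exactly the CONSTRUCTION-SHAPED classes, which are TYPED
(missing-input `Prop`s), NOT attempted. This is not "finishing BSD". Team n1011 (N10/N11; ROUTE 1,
the PORT anatomy (P-KIM) of class X4 ∧ `p = 3`): research route on CONSTRUCTION-SHAPED classes;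
prove what is provable now; no claim beyond stated classes; census output = EVIDENCE, never a
Literature fact; RESIDUAL-MAP marks UNCHANGED; nothing is booked by this file. TOOL THEOREMS ONLY:
no definition, no named fact, no instance, no `sorry`.

## What

`n = ∏_i ℓ_i` distinct primes, `G = (ℤ/n)ˣ`, `ψ` a Dirichlet character mod `n` with conductor `n₀`
and primitive character `ψ₀`; `ψ(Z) = lift ψ Z` the `ψ`-component of `Z ∈ ℚ[G]` or `ℂ[G]`.
§0: complexification `ℚ[G] → ℂ[G]` preserves components and is injective. §1 ★ the datum
`Θ̂ ∈ ℂ[G]` of PK-4b-C4b-1 `exists_pullback_eq_family` (`Θ_d = (∏_{j∉d} N_j)(∏_{i∈d}(e_i M_i + 1 − e_i)) Θ̂`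
for every `d`) has components `ψ(Θ̂) = Σ_{b∈(ℤ/n₀)ˣ} [b/n₀]⁺ ψ₀(b)` — read off at the conductor
level `d₀ = {i : ℓ_i ∣ n₀}` (`n_{d₀} = n₀`; there every `N_j(ψ) = ℓ_j − 1` and every local factor has
component `1`). §2: level arithmetic — `n` is square-free with prime factors the `ℓ_i`,
`n/n₀ = ∏_{ℓ_i ∤ n₀} ℓ_i`, and for `(M, n) = 1` the primes `q ∣ n·M`, `q ∤ n₀` (Kato's depletion set
minus the conductor) are the `ℓ_i ∤ n₀` and all primes of `M`. §3: the group-ring elements of the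
Kato side and their components — the `n`-normalised Kato factors `K_i = a_i − δ_{λ_i⁻¹} − ℓ_i δ_{λ_i}`
(`ψ(K_i) = a_i − ψ₀⁻¹(ℓ_i) − ℓ_i ψ₀(ℓ_i)`), the depletion element
`E = ∏_{q ∣ M}(1 − (a_q/q) δ_{[q]⁻¹} + 𝟙_{q∤N} q⁻¹ δ_{[q]⁻²})` (`ψ(E) = ∏ E_q(ψ₀⁻¹)`, Kato's
`S`-depleted Euler factors in PK-4a's token shape) and the cusp element `C⁻` (`ψ(C⁻) = R⁻_ψ`, Kato's
four-cusp factor `cuspFactor f true ψ c d a A d′` verbatim). Consumer: PK-4b-C4b-2 (ii)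
`KatoAvatarEulerFactorFamily` (the `hX` of PK-4b-C3). HONEST LIMITS: bookkeeping over ℂ; no Kato
object (no `ZetaBody`), no integrality; closes nothing.

References: K. Kato, Astérisque 295 (2004) Thm. 6.6 (1) p. 163, §6.2 p. 161, Lemma 13.10 (1) p. 230
[Kato2004Asterisque]; K. Ota, arXiv:1509.00682 Prop. 2.3 (1) [Ota2018]; B. Mazur, J. Tate, Duke
Math. J. 54 (1987) §1; r1 ROUTE-1 §55–57 (cells/n1011/ROUTE-1.md);
`HOME/b2b-bsdres-n1011-p15/g9/pk4/PK4b-C4-DESIGN.md`.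
-/

noncomputable section

namespace Summit.BirchSwinnertonDyer.Rank1Residual.GaloisImage

namespace EulerFactorComparison

open Finset MonoidAlgebra
open scoped BigOperators
open Literature.NumberTheory.EllipticCurves Literature.NumberTheory.EllipticCurves.ModularForms
open Literature.NumberTheory.EllipticCurves.Kato2004.EulerSystemValues
open CongruenceSubgroup

/-! ### §0 Complexification of `ℚ[(ℤ/n)ˣ]` -/

section Complexify

variable (n : ℕ) [NeZero n]

/-- A character component of the complexified element is the component of the element:
`lift_ℂ φ (X^ℂ) = lift_ℚ φ X`. [folklore] -/
theorem lift_mapRingHom_algebraMap (φ : (ZMod n)ˣ →* ℂ) (X : MonoidAlgebra ℚ (ZMod n)ˣ) :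
    MonoidAlgebra.lift ℂ ℂ (ZMod n)ˣ φ (MonoidAlgebra.mapRingHom (ZMod n)ˣ (algebraMap ℚ ℂ) X) =
      MonoidAlgebra.lift ℚ ℂ (ZMod n)ˣ φ X := by
  classical
  have hX : X = ∑ b : (ZMod n)ˣ, single b (X.coeff b) := by
    conv_lhs => rw [← MonoidAlgebra.sum_coeff_single X]
    rw [Finsupp.sum_fintype]
    intro b
    simp
  rw [hX, map_sum, map_sum, map_sum]
  refine Finset.sum_congr rfl fun g _ => ?_
  rw [MonoidAlgebra.mapRingHom_single, lift_single, lift_single, Algebra.smul_def, Algebra.smul_def]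
  rfl

omit [NeZero n] in
/-- Complexification `ℚ[(ℤ/n)ˣ] → ℂ[(ℤ/n)ˣ]` is injective. [folklore] -/
theorem mapRingHom_algebraMap_injective :
    Function.Injective (MonoidAlgebra.mapRingHom (ZMod n)ˣ (algebraMap ℚ ℂ)) := by
  intro X Y h
  refine MonoidAlgebra.coeff_injective (Finsupp.ext fun g => ?_)
  have := congrArg (fun Z => MonoidAlgebra.coeff Z g) h
  simp only [MonoidAlgebra.coeff_mapRingHom] at this
  exact (algebraMap ℚ ℂ).injective this

/-- A Dirichlet character vanishes off the units, so a character-weighted sum over `ZMod m` is the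
sum over `(ZMod m)ˣ`. [folklore] -/
theorem sum_mul_eq_sum_units_mul {m : ℕ} [NeZero m] (χ : DirichletCharacter ℂ m) (F : ZMod m → ℂ) :
    ∑ b : ZMod m, χ b * F b = ∑ b : (ZMod m)ˣ, χ (b : ZMod m) * F b := by
  classical
  have h1 : ∑ b : (ZMod m)ˣ, χ (b : ZMod m) * F b =
      ∑ x ∈ (Finset.univ : Finset (ZMod m)ˣ).map ⟨Units.val, fun _ _ h => Units.ext h⟩, χ x * F x := by
    rw [Finset.sum_map]
    rfl
  rw [h1]
  symm
  refine Finset.sum_subset (Finset.subset_univ _) fun x _ hx => ?_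
  have hxu : ¬ IsUnit x := fun hu => hx (Finset.mem_map.2 ⟨hu.unit, Finset.mem_univ _, rfl⟩)
  rw [MulChar.map_nonunit χ hxu, zero_mul]

end Complexify

/-! ### §1 The components of the Mazur–Tate datum `Θ̂` -/

section Datum

variable {ι : Type*} [Fintype ι] [DecidableEq ι] (ℓ : ι → ℕ) [hℓ : ∀ i, Fact (ℓ i).Prime]
  (hinj : Function.Injective ℓ) {n : ℕ} [NeZero n] (hn : ∏ i, ℓ i = n)
  {N : ℕ} [NeZero N] (f : CuspForm (Gamma0 N) 2)

omit [NeZero N] in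
include hinj hn in
/-- **The components of the datum.** If `Θ̂ ∈ ℂ[(ℤ/n)ˣ]` generates the pull-backs of `θ̃_f(n_d)`
(`Θ_d = (∏_{j∉d} N_j)(∏_{i∈d}(e_i M_i + 1 − e_i)) Θ̂` for every `d`, PK-4b-C4b-1
`exists_pullback_eq_family`; the local factors `M_i` are arbitrary here), then for every `ψ` mod `n`
with conductor `n₀` and primitive character `ψ₀`: `ψ(Θ̂) = Σ_{b∈(ℤ/n₀)ˣ} [b/n₀]⁺_f ψ₀(b)` — read
off at the level `d₀ = {i : ℓ_i ∣ n₀}`, `n_{d₀} = n₀`, where every `N_j(ψ) = ℓ_j − 1` and every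
local factor has `ψ`-component `1`. [cite: Ota2018, Prop. 2.3 (1)] -/
theorem lift_datum_eq_sum_units (Nn e M : ι → MonoidAlgebra ℂ (ZMod n)ˣ)
    (hN : ∀ j, Nn j = ∑ h ∈ univ.filter (· ∈ (ZMod.unitsMap (prod_dvd_of_prod_eq ℓ hn (univ.erase j))).ker),
      single h (1 : ℂ))
    (he : ∀ j, e j = (((ℓ j - 1 : ℕ) : ℂ))⁻¹ • Nn j)
    (Θ : MonoidAlgebra ℂ (ZMod n)ˣ)
    (hΘ : ∀ d : Finset ι,
      haveI : NeZero (∏ i ∈ d, ℓ i) := ⟨Finset.prod_ne_zero_iff.mpr fun i _ => (hℓ i).out.ne_zero⟩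
      (∑ g : (ZMod n)ˣ, single g (algebraMap ℚ ℂ (ratPlusSymbol f
          ((((ZMod.unitsMap (prod_dvd_of_prod_eq ℓ hn d) g : (ZMod (∏ i ∈ d, ℓ i))ˣ) :
            ZMod (∏ i ∈ d, ℓ i)).val : ℚ) / (∏ i ∈ d, ℓ i : ℕ))))) =
        (∏ j ∈ univ \ d, Nn j) * (∏ i ∈ d, (e i * M i + (1 - e i))) * Θ)
    (ψ : DirichletCharacter ℂ n) :
    haveI : NeZero ψ.conductor := ⟨ψ.conductor_ne_zero⟩
    MonoidAlgebra.lift ℂ ℂ (ZMod n)ˣ ((Units.coeHom ℂ).comp ψ.toUnitHom) Θ =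
      ∑ b : (ZMod ψ.conductor)ˣ, algebraMap ℚ ℂ (ratPlusSymbol f
        (((b : ZMod ψ.conductor).val : ℚ) / ψ.conductor)) * ψ.primitiveCharacter (b : ZMod ψ.conductor) := by
  classical
  haveI : NeZero ψ.conductor := ⟨ψ.conductor_ne_zero⟩
  -- the conductor level `d₀`
  set d₀ : Finset ι := univ.filter (fun i => ℓ i ∣ ψ.conductor) with hd₀
  have hcn : ψ.conductor ∣ ∏ i, ℓ i := by rw [hn]; exact ψ.conductor_dvd_level
  have hc : ψ.conductor = ∏ i ∈ d₀, ℓ i := eq_prod_filter_of_dvd_prod ℓ hinj hcn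
  haveI hnd : NeZero (∏ i ∈ d₀, ℓ i) := ⟨Finset.prod_ne_zero_iff.mpr fun i _ => (hℓ i).out.ne_zero⟩
  have hcond : ψ.conductor ∣ ∏ i ∈ d₀, ℓ i := dvd_of_eq hc
  have hℓ1 : ∀ j, (((ℓ j - 1 : ℕ)) : ℂ) ≠ 0 := fun j => by
    exact_mod_cast (Nat.sub_pos_of_lt (hℓ j).out.one_lt).ne'
  -- components of the prefactors at `ψ`
  have hNψ : ∀ j ∈ univ \ d₀, MonoidAlgebra.lift ℂ ℂ (ZMod n)ˣ ((Units.coeHom ℂ).comp ψ.toUnitHom) (Nn j) =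
      (((ℓ j - 1 : ℕ)) : ℂ) := fun j hj => by
    have hj' : ¬ ℓ j ∣ ψ.conductor := by
      have := (Finset.mem_sdiff.mp hj).2
      rwa [hd₀, Finset.mem_filter, not_and, imp_iff_right (Finset.mem_univ j)] at this
    rw [hN j, lift_norm_erase_eq ℓ hinj hn j ψ,
      if_pos ((dvd_prod_erase_iff_not_dvd ℓ hinj hn ψ.conductor_dvd_level j).mpr hj')]
  have hfacψ : ∀ i ∈ d₀, MonoidAlgebra.lift ℂ ℂ (ZMod n)ˣ ((Units.coeHom ℂ).comp ψ.toUnitHom)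
      (e i * M i + (1 - e i)) = 1 := fun i hi => by
    have hi' : ℓ i ∣ ψ.conductor := (Finset.mem_filter.mp hi).2
    have hei : MonoidAlgebra.lift ℂ ℂ (ZMod n)ˣ ((Units.coeHom ℂ).comp ψ.toUnitHom) (e i) = 0 := by
      rw [he i, map_smul, hN i, lift_norm_erase_eq ℓ hinj hn i ψ,
        if_neg (fun h => (dvd_prod_erase_iff_not_dvd ℓ hinj hn ψ.conductor_dvd_level i).mp h hi'),
        smul_zero]
    rw [map_add, map_mul, map_sub, map_one, hei, zero_mul, sub_zero, zero_add]
  -- apply `ψ` to the family identity at `d₀`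
  have key := congrArg (MonoidAlgebra.lift ℂ ℂ (ZMod n)ˣ ((Units.coeHom ℂ).comp ψ.toUnitHom)) (hΘ d₀)
  simp only [map_mul, map_prod] at key
  rw [Finset.prod_congr rfl hNψ, Finset.prod_congr rfl hfacψ, Finset.prod_const_one, mul_one] at key
  -- the left side: `ψ` factors through `n_{d₀} = n₀`
  obtain ⟨hdvd, ψd, hψd⟩ := (DirichletCharacter.mem_conductorSet_iff_conductor_dvd ψ
    (prod_dvd_of_prod_eq ℓ hn d₀)).mpr hcond
  have hψd' : ψd = DirichletCharacter.changeLevel hcond ψ.primitiveCharacter := by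
    apply DirichletCharacter.changeLevel_injective (prod_dvd_of_prod_eq ℓ hn d₀)
    rw [← hψd, ← DirichletCharacter.changeLevel_trans, DirichletCharacter.changeLevel_primitiveCharacter]
  have hL : MonoidAlgebra.lift ℂ ℂ (ZMod n)ˣ ((Units.coeHom ℂ).comp ψ.toUnitHom)
      (∑ g : (ZMod n)ˣ, single g (algebraMap ℚ ℂ (ratPlusSymbol f
          ((((ZMod.unitsMap (prod_dvd_of_prod_eq ℓ hn d₀) g : (ZMod (∏ i ∈ d₀, ℓ i))ˣ) :
            ZMod (∏ i ∈ d₀, ℓ i)).val : ℚ) / (∏ i ∈ d₀, ℓ i : ℕ))))) =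
      (∏ j ∈ univ \ d₀, (((ℓ j - 1 : ℕ)) : ℂ)) *
        ∑ b : (ZMod ψ.conductor)ˣ, algebraMap ℚ ℂ (ratPlusSymbol f
          (((b : ZMod ψ.conductor).val : ℚ) / ψ.conductor)) * ψ.primitiveCharacter (b : ZMod ψ.conductor) := by
    conv_lhs => rw [hψd]
    rw [lift_sum_single_comp_unitsMap_of_changeLevel (prod_dvd_of_prod_eq ℓ hn d₀)
      (fun h => algebraMap ℚ ℂ (ratPlusSymbol f ((((h : (ZMod (∏ i ∈ d₀, ℓ i))ˣ) : ZMod (∏ i ∈ d₀, ℓ i)).val : ℚ) /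
        (∏ i ∈ d₀, ℓ i : ℕ)))) ψd,
      card_ker_unitsMap_prod ℓ hinj hn d₀, hψd', Nat.cast_prod,
      sum_units_changeLevel_congr f hc.symm hcond (dvd_refl _) ψ.primitiveCharacter,
      DirichletCharacter.changeLevel_self]
  rw [hL] at key
  exact (mul_right_injective₀ (Finset.prod_ne_zero_iff.mpr fun j _ => hℓ1 j) key).symm

end Datum

/-! ### §2 Level arithmetic for the depletion modulus -/

section LevelArith

variable {ι : Type*} [Fintype ι] [DecidableEq ι] (ℓ : ι → ℕ) [hℓ : ∀ i, Fact (ℓ i).Prime]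
  (hinj : Function.Injective ℓ) {n : ℕ} [NeZero n] (hn : ∏ i, ℓ i = n)

omit [DecidableEq ι] [NeZero n] in
include hinj hn in
/-- The prime factors of `n = ∏_i ℓ_i` are the `ℓ_i`. [folklore] -/
theorem primeFactors_eq_image : n.primeFactors = univ.image ℓ := by
  classical
  rw [← hn, show (∏ i, ℓ i) = ∏ q ∈ univ.image ℓ, q from
    (Finset.prod_image (f := fun q : ℕ => q) fun i _ j _ h => hinj h).symm]
  exact Nat.primeFactors_prod fun q hq => by
    obtain ⟨i, -, rfl⟩ := Finset.mem_image.mp hq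
    exact (hℓ i).out

omit [DecidableEq ι] [NeZero n] in
include hinj hn in
/-- `n = ∏_i ℓ_i` (distinct primes) is square-free. [folklore] -/
theorem squarefree_of_prod_eq : Squarefree n := by
  classical
  rw [← hn, show (∏ i, ℓ i) = ∏ q ∈ univ.image ℓ, q from
    (Finset.prod_image (f := fun q : ℕ => q) fun i _ j _ h => hinj h).symm]
  refine Finset.squarefree_prod_of_pairwise_isCoprime ?_ fun q hq => ?_
  · intro q hq q' hq' hne
    obtain ⟨i, -, rfl⟩ := Finset.mem_image.mp (Finset.mem_coe.mp hq)
    obtain ⟨j, -, rfl⟩ := Finset.mem_image.mp (Finset.mem_coe.mp hq')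
    exact Nat.coprime_iff_isRelPrime.mp ((Nat.coprime_primes (hℓ i).out (hℓ j).out).mpr hne)
  · obtain ⟨i, -, rfl⟩ := Finset.mem_image.mp hq
    exact (hℓ i).out.prime.squarefree

omit [NeZero n] in
include hinj hn in
/-- `n / n₀ = ∏_{ℓ_i ∤ n₀} ℓ_i` for `n₀ ∣ n`. [folklore] -/
theorem div_eq_prod_filter_not_dvd {n₀ : ℕ} (hn₀ : n₀ ∣ n) :
    n / n₀ = ∏ i ∈ univ.filter (fun i => ¬ ℓ i ∣ n₀), ℓ i := by
  have hcn : n₀ ∣ ∏ i, ℓ i := by rw [hn]; exact hn₀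
  have hc : n₀ = ∏ i ∈ univ.filter (fun i => ℓ i ∣ n₀), ℓ i := eq_prod_filter_of_dvd_prod ℓ hinj hcn
  have h := prod_eq_mul_prod_filter_not ℓ hc
  rw [hn] at h
  rw [h, Nat.mul_div_cancel_left _ (Nat.pos_of_ne_zero fun h0 => by
    rw [h0] at hc; exact (Finset.prod_ne_zero_iff.mpr fun i _ => (hℓ i).out.ne_zero) hc.symm)]

omit [DecidableEq ι] [NeZero n] in
include hinj hn in
/-- **Splitting the depleted Euler product**: for `(M, n) = 1` and `n₀ ∣ n`, the primes `q ∣ n·M` with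
`q ∤ n₀` are the `ℓ_i ∤ n₀` together with ALL primes of `M`. [folklore] -/
theorem prod_filter_primeFactors_mul_eq {M : ℕ} (hM0 : M ≠ 0) (hM : M.Coprime n) {n₀ : ℕ}
    (hn₀ : n₀ ∣ n) {β : Type*} [CommMonoid β] (F : ℕ → β) :
    ∏ q ∈ (n * M).primeFactors.filter (fun q => ¬ q ∣ n₀), F q =
      (∏ i ∈ univ.filter (fun i => ¬ ℓ i ∣ n₀), F (ℓ i)) * ∏ q ∈ M.primeFactors, F q := by
  classical
  have hn0 : n ≠ 0 := by rw [← hn]; exact Finset.prod_ne_zero_iff.mpr fun i _ => (hℓ i).out.ne_zero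
  rw [Nat.primeFactors_mul hn0 hM0, Finset.filter_union, Finset.prod_union
    (Finset.disjoint_filter_filter (Nat.Coprime.disjoint_primeFactors hM.symm))]
  congr 1
  · rw [primeFactors_eq_image ℓ hinj hn, Finset.filter_image,
      Finset.prod_image fun i _ j _ h => hinj h]
  · refine Finset.prod_congr (Finset.filter_true_of_mem fun q hq hqn₀ => ?_) fun _ _ => rfl
    have hq := Nat.prime_of_mem_primeFactors hq
    exact hq.one_lt.ne' (Nat.Coprime.eq_one_of_dvd
      (Nat.Coprime.of_dvd_left (Nat.dvd_of_mem_primeFactors ‹q ∈ M.primeFactors›) hM) (hqn₀.trans hn₀))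

end LevelArith

/-! ### §3 The group-ring elements of the Kato side and their components -/

section Elements

variable {n : ℕ} (ψ : DirichletCharacter ℂ n)

/-- `ψ(q • δ_g) = q · ψ(g)` (rational coefficient). [folklore] -/
theorem liftQ_single (g : (ZMod n)ˣ) (q : ℚ) :
    MonoidAlgebra.lift ℚ ℂ (ZMod n)ˣ ((Units.coeHom ℂ).comp ψ.toUnitHom) (single g q) =
      (q : ℂ) * ψ (g : ZMod n) := by
  rw [lift_single, MonoidHom.comp_apply, Units.coeHom_apply, MulChar.coe_toUnitHom, Rat.smul_def]

/-- `ψ(q · 1) = q`. [folklore] -/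
theorem liftQ_algebraMap (q : ℚ) :
    MonoidAlgebra.lift ℚ ℂ (ZMod n)ˣ ((Units.coeHom ℂ).comp ψ.toUnitHom) (algebraMap ℚ _ q) = (q : ℂ) := by
  rw [AlgHom.commutes, eq_ratCast]

/-- `ψ(1 + δ₋₁) = 1 + ψ(−1)` (rational coefficients). [folklore] -/
theorem liftQ_one_add_single_neg_one :
    MonoidAlgebra.lift ℚ ℂ (ZMod n)ˣ ((Units.coeHom ℂ).comp ψ.toUnitHom)
        (1 + single (-1 : (ZMod n)ˣ) (1 : ℚ)) = 1 + ψ (-1) := by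
  rw [map_add, map_one, liftQ_single, Rat.cast_one, one_mul, Units.coe_neg_one]

/-- `ψ(1 + δ₋₁) = 1 + ψ(−1)` (complex coefficients). [folklore] -/
theorem lift_one_add_single_neg_one :
    MonoidAlgebra.lift ℂ ℂ (ZMod n)ˣ ((Units.coeHom ℂ).comp ψ.toUnitHom)
        (1 + single (-1 : (ZMod n)ˣ) (1 : ℂ)) = 1 + ψ (-1) := by
  rw [map_add, map_one, lift_single_coeHom, one_mul, Units.coe_neg_one]

/-- `ψ⁻¹ = (ψ₀⁻¹)↑`: the inverse character is induced from the inverse of the primitive character.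
[folklore] -/
theorem inv_eq_changeLevel_primitiveCharacter_inv :
    ψ⁻¹ = DirichletCharacter.changeLevel ψ.conductor_dvd_level (ψ.primitiveCharacter)⁻¹ := by
  rw [map_inv, DirichletCharacter.changeLevel_primitiveCharacter]

/-- `ψ₀(−1) = ψ(−1)`: the primitive character has the parity of `ψ`. [folklore] -/
theorem primitiveCharacter_neg_one : ψ.primitiveCharacter (-1) = ψ (-1) := by
  have h := DirichletCharacter.changeLevel_eq_cast_of_dvd' ψ.primitiveCharacter ψ.conductor_dvd_level
    (a := -1) (isCoprime_one_left.neg_left)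
  rw [DirichletCharacter.changeLevel_primitiveCharacter] at h
  push_cast at h
  exact h.symm

/-- `ψ([q]⁻¹) = ψ₀⁻¹(q)` for `q` prime to `n` (`[q]` the unit of `q` mod `n`, `ψ₀` the primitive
character of `ψ`, evaluated mod the conductor). [folklore] -/
theorem apply_inv_unit_eq_primitiveCharacter_inv {q : ℕ} (hq : q.Coprime n) (uq : (ZMod n)ˣ)
    (huq : (uq : ZMod n) = q) :
    ψ ((uq⁻¹ : (ZMod n)ˣ) : ZMod n) = (ψ.primitiveCharacter)⁻¹ (q : ZMod ψ.conductor) := by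
  rw [CharComponent.apply_coe_inv_eq_inv_apply ψ uq, inv_eq_changeLevel_primitiveCharacter_inv, huq]
  have h := DirichletCharacter.changeLevel_eq_cast_of_dvd' (ψ.primitiveCharacter)⁻¹ ψ.conductor_dvd_level
    (a := (q : ℤ)) (Nat.isCoprime_iff_coprime.mpr hq)
  push_cast at h
  exact h

/-- **Components of the `n`-normalised Kato factor** `K_i = a_i − δ_{λ_i⁻¹} − ℓ_i δ_{λ_i}` at a
character whose conductor is prime to `ℓ_i`: `ψ(K_i) = a_i − ψ₀⁻¹(ℓ_i) − ℓ_i ψ₀(ℓ_i)`.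
[cite: Kato2004Asterisque, §6.2 (p. 161)] -/
theorem liftQ_katoFactor_eq {ι : Type*} [Fintype ι] [DecidableEq ι] (ℓ : ι → ℕ)
    (hn : ∏ i, ℓ i = n) (j : ι) (hψ : ψ.conductor ∣ ∏ i ∈ univ.erase j, ℓ i) (lam : (ZMod n)ˣ)
    (hlam : ((ZMod.unitsMap (prod_dvd_of_prod_eq ℓ hn (univ.erase j)) lam : (ZMod (∏ i ∈ univ.erase j, ℓ i))ˣ) :
      ZMod (∏ i ∈ univ.erase j, ℓ i)) = (ℓ j : ZMod (∏ i ∈ univ.erase j, ℓ i))) (a : ℤ)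
    (K : MonoidAlgebra ℚ (ZMod n)ˣ)
    (hK : K = algebraMap ℚ _ (a : ℚ) - single lam⁻¹ (1 : ℚ) - single lam (ℓ j : ℚ)) :
    MonoidAlgebra.lift ℚ ℂ (ZMod n)ˣ ((Units.coeHom ℂ).comp ψ.toUnitHom) K =
      (a : ℂ) - (ψ.primitiveCharacter)⁻¹ (ℓ j : ZMod ψ.conductor) -
        (ℓ j : ℂ) * ψ.primitiveCharacter (ℓ j : ZMod ψ.conductor) := by
  rw [hK, map_sub, map_sub, liftQ_algebraMap, liftQ_single, liftQ_single, Rat.cast_one, one_mul,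
    Rat.cast_intCast, Rat.cast_natCast, apply_lift_eq_primitiveCharacter ℓ hn j ψ hψ lam hlam,
    apply_lift_inv_eq_primitiveCharacter ℓ hn j ψ hψ lam hlam]

/-- **Components of the depletion element** `E = ∏_{q ∣ M} (1 − (a_q/q) δ_{[q]⁻¹} + 𝟙_{q∤N} q⁻¹ δ_{[q]⁻²})`
(`(M, n) = 1`): `ψ(E) = ∏_{q ∣ M} E_q(ψ₀⁻¹)`, Kato's `S`-depleted Euler factors
`E_q(χ₀) = 1 − χ₀(q) a_q q⁻¹ + 𝟙_{q∤N} q χ₀(q)² q⁻²` in PK-4a's token shape.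
[cite: Kato2004Asterisque, §6.2 (p. 161)] -/
theorem liftQ_depletion_eq {N : ℕ} (f : CuspForm (Gamma0 N) 2) {M : ℕ} (hM : M.Coprime n)
    (uq : ℕ → (ZMod n)ˣ) (huq : ∀ q ∈ M.primeFactors, ((uq q : (ZMod n)ˣ) : ZMod n) = q)
    (aM : ℕ → ℤ) (haM : ∀ q ∈ M.primeFactors, cuspCoeff f q = aM q)
    (E : MonoidAlgebra ℚ (ZMod n)ˣ)
    (hE : E = ∏ q ∈ M.primeFactors, (1 - single (uq q)⁻¹ ((aM q : ℚ) / q) +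
      single ((uq q)⁻¹ ^ 2) (if q ∣ N then 0 else (1 / q : ℚ)))) :
    MonoidAlgebra.lift ℚ ℂ (ZMod n)ˣ ((Units.coeHom ℂ).comp ψ.toUnitHom) E =
      ∏ q ∈ M.primeFactors,
        (1 - (ψ.primitiveCharacter)⁻¹ (q : ZMod ψ.conductor) * cuspCoeff f q * (q : ℂ) ^ (-(1 : ℂ)) +
          (if q ∣ N then 0 else (q : ℂ)) * (ψ.primitiveCharacter)⁻¹ (q : ZMod ψ.conductor) ^ 2 *
            ((q : ℂ) ^ (-(1 : ℂ))) ^ 2) := by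
  rw [hE, map_prod]
  refine Finset.prod_congr rfl fun q hq => ?_
  have hq0 : (q : ℂ) ≠ 0 := by exact_mod_cast (Nat.prime_of_mem_primeFactors hq).ne_zero
  have hcop : q.Coprime n := Nat.Coprime.of_dvd_left (Nat.dvd_of_mem_primeFactors hq) hM
  rw [map_add, map_sub, map_one, liftQ_single, liftQ_single, Units.val_pow_eq_pow_val, map_pow,
    apply_inv_unit_eq_primitiveCharacter_inv ψ hcop (uq q) (huq q hq), haM q hq, Complex.cpow_neg_one]
  by_cases hqN : q ∣ N
  · rw [if_pos hqN, if_pos hqN]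
    push_cast
    field_simp
    ring
  · rw [if_neg hqN, if_neg hqN]
    push_cast
    field_simp

/-- **Components of the cusp element**
`C⁻ = c²d²[a/A]⁻ − cd²[ac/A]⁻ δ_{[c]} − c²d[ad′/A]⁻ δ_{[d]} + cd[acd′/A]⁻ δ_{[cd]}` (`c, d` units mod `n`):
`ψ(C⁻) = R⁻_{ψ} = cuspFactor f true ψ c d a A d′`, Kato's four-cusp factor (even parity) verbatim.
[cite: Kato2004Asterisque, Thm. 6.6 (1) (p. 163) and Lemma 13.10 (1) (p. 230)] -/
theorem liftQ_cusp_eq {N : ℕ} (f : CuspForm (Gamma0 N) 2) (c d a : ℤ) (A : ℕ) (d' : ℤ)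
    (uc ud : (ZMod n)ˣ) (huc : (uc : ZMod n) = c) (hud : (ud : ZMod n) = d)
    (C : MonoidAlgebra ℚ (ZMod n)ˣ)
    (hC : C = algebraMap ℚ _ ((c : ℚ) ^ 2 * (d : ℚ) ^ 2 * ratMinusSymbol f ((a : ℚ) / A)) -
      single uc ((c : ℚ) * (d : ℚ) ^ 2 * ratMinusSymbol f ((a * c : ℚ) / A)) -
      single ud ((c : ℚ) ^ 2 * (d : ℚ) * ratMinusSymbol f ((a * d' : ℚ) / A)) +
      single (uc * ud) ((c : ℚ) * (d : ℚ) * ratMinusSymbol f ((a * c * d' : ℚ) / A))) :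
    MonoidAlgebra.lift ℚ ℂ (ZMod n)ˣ ((Units.coeHom ℂ).comp ψ.toUnitHom) C =
      cuspFactor f true (fun j => ψ (j : ZMod n)) c d a A d' := by
  rw [hC, map_add, map_sub, map_sub, liftQ_algebraMap, liftQ_single, liftQ_single, liftQ_single,
    Units.val_mul, huc, hud]
  simp only [cuspFactor, if_true]
  push_cast
  ring

end Elements

end EulerFactorComparison

end Summit.BirchSwinnertonDyer.Rank1Residual.GaloisImage

end
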